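import Summits.BirchSwinnertonDyer.Rank1Residual.GaloisImage.LocalThreeTorsionAdicCompletion
import Summits.BirchSwinnertonDyer.Rank1Residual.GaloisImage.LocalTorsionAwayFromPAdicCompletion
import Summits.BirchSwinnertonDyer.Rank1Residual.Additive.X4RankZeroVisibleLowerBoundPrimeList
import Summits.BirchSwinnertonDyer.Rank1Residual.GaloisImage.VisThreeESideInstances7
import Summits.BirchSwinnertonDyer.Rank1Residual.Additive.IntModelTamagawaCertificateLocal
import Summits.BirchSwinnertonDyer.Rank1Residual.Additive.JValuationOfIntModel
import Summits.BirchSwinnertonDyer.Rank1Residual.X11b.VisibilityPrimeList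
import Literature.NumberTheory.EllipticCurves.SelmerCorankControlRatProofs
import Summits.BirchSwinnertonDyer.Rank1Residual.GaloisImage.VisThreeESideInstances8
import HarnessLib

/-!
# T-VIS3 ROW SHAPES (PACKED, 2 rows): `BSD(E,3)` for `50562bj1`, `50562bm1` from their `3`-CONGRUENT rank-2 partners,
# every local binder `hloc` IN THE KERNEL (team n1011, ROW T-VIS3-REC over n1011-p14's T-VIS3-REC-E E-side instances; written and filed by
# seat p18 GEN 11 under the standing rulings R5-82 (d) / R5-84 (b)(n) / R5-85 (n) / R5-87 (k) and the lead R5-108 (b) 'T-VIS3-REC COMPACT = YES under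
# R5-107 (a)'s conditions' — the two batch-4 rows of p14 FILES 7/8 that share the partner `50562bh1`: GEN 10's compact file 4 p327174 bounced because
# `50562bm1` imported a sibling module `X4ThreeVisibleRowShape50562bj1` that was never filed (GEN 10 mistook p322512 = `46350bj1` for it); both rows are
# filed HERE in one module, the shared partner certificates declared once; nothing mathematical changed)

HONEST FRAMING (cell `b2b-bsdres`, run/shared/lean/b2b/bsd-rank1-residual/, verbatim in every
file): the goal of the cell is to DELETE the COMBINATION-SHAPED residual classes of the
Birch–Swinnerton-Dyer formula for ALL analytic-rank `≤ 1` elliptic curves over `ℚ` — "full BSD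
formula for every rank `≤ 1` curve in class `C`" assembled STRICTLY from published theorems — so
that the rank-`≤ 1` remainder becomes exactly the CONSTRUCTION-SHAPED classes, which are TYPED
(missing-input `Prop`s), NOT attempted. This is not "finishing BSD". Team n1011 (N11 = X4 ∧ `p = 3`),
research route; a ROW SHAPE closes NO class and moves no mark / label / count; nothing booked;
theorems only (no definition, no named fact, no `sorry`).

RULING OF RECORD for T-VIS3 row shapes (n1011 lead GEN 8, R5-82 (d), 2026-08-21T21:58Z, verbatim): "T-VIS3 (iv) ROW
SHAPE — evidence columns displayed as binders, provenance: θ = r1 g29 tables (+ KO/Fisher certificate when landed),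
rank E′ = Cremona/bsdr2, r_an/#Ш_an = Cremona allbsd + engine P; nothing booked; closes nothing beyond its displayed
binders; census count unchanged".  The rows below are EXACTLY the one-row shapes of `tools/vis3_rowshape.py`
(n1011-p18), concatenated: same binders, same kernel certificates, same END; only the file is shared.

## What (one paragraph per row)

**`bsdp3_vis_v50562bj1`** — the N11 row `50562bj1 = [1, -1, 1, 530374, -13201203]` (`N = 50562`; X4 at `3`, potentially GOOD row (`0 ≤ ord₃ j`, a = 2; `3 ∤ ∏ c_ℓ`); `r_an = 0`,
`#Ш_an = 9`) with the `3`-congruent partner `50562bh1 = [1, -1, 1, -2912, 192003]` of Mordell–Weil rank `2` (r1 ROUTE-1 §41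
`g29_cvis_pairs.tsv`, verdict PASS-rank: the place `3` PAID with `#E′(ℚ₃)[3] = 1`, every other place free
of kind (i)), over n1011-p03's visibility END (p304185) in prime-list form
(`Additive/X4RankZeroVisibleLowerBoundPrimeList.lean`, p307030).  KERNEL: `E′` elliptic and globally minimal
(bounded Kraus criterion), `|Δ(E)| = 2²·3⁶·53⁹`, `|Δ(E′)| = 2¹⁷·3⁶·53³` (`S` = places over `[2, 3, 53]`), the E-side
facts of `GaloisImage/VisThreeESideInstances7.lean`, and the partner's local binders at every place of `S` via
`GaloisImage/LocalThreeTorsionAdicCompletion.lean` (place `3`, n1011-p17's decider) /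
`GaloisImage/LocalTorsionAwayFromPAdicCompletion.lean` (places `≠ 3`, numeric test `3 ∤ c_v·N_ℓ` from ONE
Tate / nodal certificate).  BINDERS LEFT = the named facts ∪ {`hr`, `hq`/`hv` (`#Ш_an`)} ∪ {`θ`/`hθ`
(the `3`-congruence), `hrank` (`2 ≤ rank E′`)} ∪ {`D`, `hc` (Manin datum)} — EVIDENCE columns, not booked. NO port, NO
Poitou–Tate, NO Kurihara number.  Generated by `tools/vis3_rowshape.py` (n1011-p18) from r1's table,
p17's `loc3t_cert2.py` and the observatory's `tate_deep.py` (unchanged); every certificate re-verified by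
`decide +kernel`.

**`bsdp3_vis_v50562bm1`** — the N11 row `50562bm1 = [1, -1, 1, -51725453, 143963661219]` (`N = 50562`; X4 at `3`, (M) row (`ord₃ j < 0`, a = 2); `r_an = 0`,
`#Ш_an = 9`) with the `3`-congruent partner `50562bh1 = [1, -1, 1, -2912, 192003]` of Mordell–Weil rank `2` (r1 ROUTE-1 §41
`g29_cvis_pairs.tsv`, verdict PASS-rank: the place `3` PAID with `#E′(ℚ₃)[3] = 1`, every other place free
of kind (i)), over n1011-p03's visibility END (p304185) in prime-list form
(`Additive/X4RankZeroVisibleLowerBoundPrimeList.lean`, p307030).  KERNEL: `E′` elliptic and globally minimal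
(bounded Kraus criterion), `|Δ(E)| = 2¹·3¹⁵·53⁹`, `|Δ(E′)| = 2¹⁷·3⁶·53³` (`S` = places over `[2, 3, 53]`), the E-side
facts of `GaloisImage/VisThreeESideInstances8.lean`, and the partner's local binders at every place of `S` via
`GaloisImage/LocalThreeTorsionAdicCompletion.lean` (place `3`, n1011-p17's decider) /
`GaloisImage/LocalTorsionAwayFromPAdicCompletion.lean` (places `≠ 3`, numeric test `3 ∤ c_v·N_ℓ` from ONE
Tate / nodal certificate).  BINDERS LEFT = the named facts ∪ {`hr`, `hq`/`hv` (`#Ш_an`)} ∪ {`θ`/`hθ`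
(the `3`-congruence), `hrank` (`2 ≤ rank E′`)} — EVIDENCE columns, not booked. NO port, NO
Poitou–Tate, NO Kurihara number.  Generated by `tools/vis3_rowshape.py` (n1011-p18) from r1's table,
p17's `loc3t_cert2.py` and the observatory's `tate_deep.py` (unchanged); every certificate re-verified by
`decide +kernel`.

References: [CremonaMazur2000] §3; [AgasheStein2002] Thm. 3.1; [Delbourgo1998] Prop. 4; [Kato2004Asterisque]
Thm. 14.5; [SilvermanAEC2009] VII.2.1, VII.5.1, X.4.2, X.4.14; [SilvermanATAEC1994] IV.9.4; [Cremona2006].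
-/

set_option autoImplicit false

noncomputable section

open scoped Classical NumberField
open IsDedekindDomain NumberField WeierstrassCurve Rat.HeightOneSpectrum
  Literature.NumberTheory.EllipticCurves Literature.NumberTheory.EllipticCurves.ModularForms
  Literature.NumberTheory.EllipticCurves.Rank1Residual
  Literature.NumberTheory.EllipticCurves.Rank1Residual.Typed
  Literature.NumberTheory.GaloisRepresentations
  Summit.BirchSwinnertonDyer.BirchSwinnertonDyer.Rank1Residual.IntModel
  Summit.BirchSwinnertonDyer.BirchSwinnertonDyer.Rank1Residual.X11RankOne
  Summit.BirchSwinnertonDyer.BirchSwinnertonDyer.Rank2Observatory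
  Summit.BirchSwinnertonDyer.BirchSwinnertonDyer.Rank2Observatory.Tam
  Summit.BirchSwinnertonDyer.Rank1Residual.GaloisImage

namespace Summit.BirchSwinnertonDyer.Rank1Residual.Additive

/-! ### Row `50562bj1` -/

/-- E-side Tamagawa ROW certificate of `50562bj1 = [1, -1, 1, 530374, -13201203]` (one local certificate per bad prime, Tate's algorithm;
`2`: split `I2`, `c = 2` (root `0`); `3`: additive `I0*`, value SET `[1, 2, 4]` (the `c` slot carries the set's largest member as a placeholder, not an engine value; the bracket theorem reads the set) (deep Tate certificate); `53`: additive `III*`, `c = 2` (deep Tate certificate)): the certified value set of `∏ c_ℓ` avoids `3`. [cite: SilvermanATAEC1994, IV.9.4] -/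
theorem tamRow_vis_v50562bj1 :
    TamLocal.rowCheck [⟨2, 1, 1, 0, 0, 0, 0, 2, 0, 0, 2⟩, ⟨3, 1, 5, 0, 2, 1, 3, 6, 6, 0, 4⟩, ⟨53, 7, 5, 0, 2107, 26, 147823, 9, 9, 0, 2⟩] ⟨1, -1, 1, 530374, -13201203⟩ = true := by
  decide +kernel

/-- The local Tamagawa certificate of the partner `50562bh1` at `2` (`TamLocal` = `⟨2, 1, 1, 0, 0, 0, 0, 17, 0, 0, 17⟩`) passes the
kernel check. [cite: SilvermanATAEC1994, IV.9.4] -/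
theorem tamLocal_check_50562bh1_2 :
    TamLocal.check ⟨2, 1, 1, 0, 0, 0, 0, 17, 0, 0, 17⟩ ⟨1, -1, 1, -2912, 192003⟩ = true := by
  decide +kernel

/-- The local Tamagawa certificate of the partner `50562bh1` at `53` (`TamLocal` = `⟨53, 7, 4, 0, 40, 0, 6, 3, 3, 2, 2⟩`; Kodaira `III`, `c = 2`) passes the
kernel check. [cite: SilvermanATAEC1994, IV.9.4] -/
theorem tamLocal_check_50562bh1_53 :
    TamLocal.check ⟨53, 7, 4, 0, 40, 0, 6, 3, 3, 2, 2⟩ ⟨1, -1, 1, -2912, 192003⟩ = true := by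
  decide +kernel

/-- **T-VIS3 ROW SHAPE (CLOSES NOTHING, moves no mark): `BSD(E,3)` for `50562bj1` from its `3`-congruent
rank-2 partner `50562bh1`, every local binder in the kernel.** [cite: CremonaMazur2000, §3 and Table 1]
[cite: SilvermanAEC2009, Thm. X.4.2 (a) and X.4.14] [cite: Cremona2006, Table 1 (labels 50562bj1, 50562bh1)] -/
theorem bsdp3_vis_v50562bj1
    (hKato : Kato2004.rankZero_padicValNat_sha_le_of_additive_potGood_of_imageContainsSL2)
    (hCT : exists_casselsTate_pairing (K := ℚ))
    (hGZK : rank_eq_analyticRank_of_analyticRank_le_one) (hmod : hasEntireLFunction_rat)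
    (W : WeierstrassCurve ℚ) [W.IsElliptic] [W.IsGloballyMinimal]
    (hI : integralModelInt W = ⟨1, -1, 1, 530374, -13201203⟩)
    (hr : W.analyticRank = 0)
    {N : ℕ} [NeZero N] (D : ModularParametrizationData W N) (hc : ¬ ((3 : ℕ) : ℤ) ∣ D.maninConstant)
    {q : ℚ} (hq : shaAn W = (q : ℂ)) (hv : padicValRat 3 q ≤ 2)
    (W' : WeierstrassCurve ℚ) (hW' : W' = ⟨1, -1, 1, -2912, 192003⟩) [W'.IsElliptic]
    (θ : geomTorsion W' ((3 : ℕ) : ℤ) ≃+ geomTorsion W ((3 : ℕ) : ℤ))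
    (hθ : ∀ (σ : Field.absoluteGaloisGroup ℚ) (P : geomTorsion W' ((3 : ℕ) : ℤ)),
      θ (σ • P) = σ • θ P)
    (hrank : 2 ≤ W'.mordellWeilRank) :
    haveI : Fact (Nat.Prime 3) := ⟨Nat.prime_three⟩
    BSDp W 3 := by
  haveI : Fact (Nat.Prime 3) := ⟨Nat.prime_three⟩
  haveI : Fact (Nat.Prime 2) := ⟨by norm_num⟩
  haveI : Fact (Nat.Prime 53) := ⟨by norm_num⟩
  -- the row `50562bj1`
  have hsurj : W.HasSurjectiveModNGaloisRep 3 := GaloisImage.surj3_frob_v50562bj1 hI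
  have hX : ClassX4 W 3 :=
    ⟨by norm_num, addv_of_intModel hI 3 (by decide) (by decide),
      hasIrreducibleModPGaloisRep_of_hasSurjectiveModNGaloisRep W 3 hsurj⟩
  have hpot : 0 ≤ padicValRat 3 W.j :=
    padicValRat_j_nonneg_of_intModel hI (p := 3) 2 (by decide) (by decide)
  have htam : ¬ 3 ∣ W.tamagawaProduct :=
    IntModelTam.not_dvd_tamagawaProduct_of_intModel_of_rowCheck hI tamRow_vis_v50562bj1 3 (by decide)
  have hE : (⟨1, -1, 1, 530374, -13201203⟩ : WeierstrassCurve ℤ).map (Int.castRingHom ℚ) = W := by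
    rw [IntModelTam.eq_baseChange_of_integralModelInt hI]; rfl
  -- the partner `50562bh1`: globally minimal, integral model
  have hM' : W'.IsGloballyMinimal := by
    rw [hW']
    exact isGloballyMinimal_of_krausCriterion_bounded 1 (-1) 1 (-2912) 192003
      (by decide +kernel) (by decide +kernel) (by decide +kernel)
  have hI' : integralModelInt W' = ⟨1, -1, 1, -2912, 192003⟩ := by
    subst hW'; exact integralModelInt_eq_of_map_eq _ (map_mk_int 1 (-1) 1 (-2912) 192003)
  have hF : (⟨1, -1, 1, -2912, 192003⟩ : WeierstrassCurve ℤ).map (Int.castRingHom ℚ) = W' := by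
    rw [hW']; exact map_mk_int 1 (-1) 1 (-2912) 192003
  refine X4RankZero.bsdp_of_congr_of_rank_two_of_kato_of_primeList hKato hCT hGZK hmod W 3 (by norm_num)
    hr hX hpot (GaloisImage.towerSurj3u_frob_v50562bj1 hI) htam D hc hq hv W' θ hθ hrank hE hF
    [2, 3, 53] (by decide)
    (X11b.forall_mem_of_natAbs_eq_prod_pow [2, 3, 53] [2, 6, 9] (by intro q hq; simp only [List.mem_cons, List.mem_nil_iff, or_false] at hq; rcases hq with rfl | rfl | rfl <;> norm_num) (by decide +kernel))
    (X11b.forall_mem_of_natAbs_eq_prod_pow [2, 3, 53] [17, 6, 3] (by intro q hq; simp only [List.mem_cons, List.mem_nil_iff, or_false] at hq; rcases hq with rfl | rfl | rfl <;> norm_num) (by decide +kernel))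
    (fun v hvL ↦ ?_)
  simp only [List.mem_cons, List.mem_nil_iff, or_false] at hvL
  rcases hvL with h2 | h3 | h53
  · -- `v = 2`: split I17, root t = 0, c = 17, N = 1
    exact LocalTorsionAway.natCard_ker_nsmul_adicCompletion_eq_one_of_intModel_of_nodal_root hI' 2 3 (by norm_num) h2 (by decide) (by decide) (t := 0) (by decide) (E := ⟨2, 1, 1, 0, 0, 0, 0, 17, 0, 0, 17⟩) rfl tamLocal_check_50562bh1_2 (c := 17) (by decide) (by norm_num)
  · -- `v = 3`: n1011-p17's decider, k = 2, cert = [[22, 1, 3, 0]], S = 0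
    exact LocalTorsion3.natCard_ker_nsmul_three_adicCompletion_eq_one_of_check 1 (-1) 1 (-2912) 192003 (by decide +kernel) (k := 2) (cert := [((22 : ℤ), 1, 3, 0)]) (by decide +kernel) W' (by rw [hW']; norm_num) h3
  · -- `v = 53`: additive Kodaira III, value set [2]
    exact LocalTorsionAway.natCard_ker_nsmul_adicCompletion_eq_one_of_intModel_of_additive hI' 53 3 (by norm_num) h53 (by decide) (by decide) (IntModelTam.localTamagawaNumber_padic_eq_of_intModel_of_tamLocal hI' 53 (E := ⟨53, 7, 4, 0, 40, 0, 6, 3, 3, 2, 2⟩) rfl tamLocal_check_50562bh1_53 (c := 2) (by decide)) (by norm_num)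

/-! ### Row `50562bm1` -/

-- `tamLocal_check_50562bh1_2`: the SHARED partner's certificate theorem is declared above (row-level dedup).

-- `tamLocal_check_50562bh1_53`: the SHARED partner's certificate theorem is declared above (row-level dedup).

/-- **T-VIS3 ROW SHAPE (CLOSES NOTHING, moves no mark): `BSD(E,3)` for `50562bm1` from its `3`-congruent
rank-2 partner `50562bh1`, every local binder in the kernel.** [cite: CremonaMazur2000, §3 and Table 1]
[cite: SilvermanAEC2009, Thm. X.4.2 (a) and X.4.14] [cite: Cremona2006, Table 1 (labels 50562bm1, 50562bh1)] -/
theorem bsdp3_vis_v50562bm1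
    (hKatoS : Kato2004.rankZero_padicValNat_sha_le_sub_localTamagawa_of_additive_potGood_of_imageContainsSL2)
    (hDel : Delbourgo1998.prop4_rankZero_pow_dvd_constantCoeff)
    (hGZK : rank_eq_analyticRank_of_analyticRank_le_one) (hmod : hasEntireLFunction_rat)
    (hmodD : nonempty_modularParametrizationData)
    (hKatoχ : Wuthrich2014.kato_halfEigenCharIdeal_dvd_cyclotomicPrime_of_surjective)
    (hCT : exists_casselsTate_pairing (K := ℚ))
    (W : WeierstrassCurve ℚ) [W.IsElliptic] [W.IsGloballyMinimal]
    (hI : integralModelInt W = ⟨1, -1, 1, -51725453, 143963661219⟩)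
    (hr : W.analyticRank = 0)
    {q : ℚ} (hq : shaAn W = (q : ℂ)) (hv : padicValRat 3 q ≤ 2)
    (W' : WeierstrassCurve ℚ) (hW' : W' = ⟨1, -1, 1, -2912, 192003⟩) [W'.IsElliptic]
    (θ : geomTorsion W' ((3 : ℕ) : ℤ) ≃+ geomTorsion W ((3 : ℕ) : ℤ))
    (hθ : ∀ (σ : Field.absoluteGaloisGroup ℚ) (P : geomTorsion W' ((3 : ℕ) : ℤ)),
      θ (σ • P) = σ • θ P)
    (hrank : 2 ≤ W'.mordellWeilRank) :
    haveI : Fact (Nat.Prime 3) := ⟨Nat.prime_three⟩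
    BSDp W 3 := by
  haveI : Fact (Nat.Prime 3) := ⟨Nat.prime_three⟩
  haveI : Fact (Nat.Prime 2) := ⟨by norm_num⟩
  haveI : Fact (Nat.Prime 53) := ⟨by norm_num⟩
  -- the row `50562bm1`
  have hsurj : W.HasSurjectiveModNGaloisRep 3 := GaloisImage.surj3_frob_v50562bm1 hI
  have hX : ClassX4 W 3 :=
    ⟨by norm_num, addv_of_intModel hI 3 (by decide) (by decide),
      hasIrreducibleModPGaloisRep_of_hasSurjectiveModNGaloisRep W 3 hsurj⟩
  have hj : padicValRat 3 W.j < 0 :=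
    padicValRat_j_neg_of_intModel hI (p := 3) 2 (by decide) (by decide)
  have hE : (⟨1, -1, 1, -51725453, 143963661219⟩ : WeierstrassCurve ℤ).map (Int.castRingHom ℚ) = W := by
    rw [IntModelTam.eq_baseChange_of_integralModelInt hI]; rfl
  -- the partner `50562bh1`: globally minimal, integral model
  have hM' : W'.IsGloballyMinimal := by
    rw [hW']
    exact isGloballyMinimal_of_krausCriterion_bounded 1 (-1) 1 (-2912) 192003
      (by decide +kernel) (by decide +kernel) (by decide +kernel)
  have hI' : integralModelInt W' = ⟨1, -1, 1, -2912, 192003⟩ := by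
    subst hW'; exact integralModelInt_eq_of_map_eq _ (map_mk_int 1 (-1) 1 (-2912) 192003)
  have hF : (⟨1, -1, 1, -2912, 192003⟩ : WeierstrassCurve ℤ).map (Int.castRingHom ℚ) = W' := by
    rw [hW']; exact map_mk_int 1 (-1) 1 (-2912) 192003
  refine X4RankZero.bsdp_three_potMult_of_congr_of_rank_two_of_primeList hKatoS hDel hGZK hmod hmodD
    hKatoχ hCT W hr hX hsurj hj hq hv W' θ hθ hrank hE hF [2, 3, 53] (by decide)
    (X11b.forall_mem_of_natAbs_eq_prod_pow [2, 3, 53] [1, 15, 9] (by intro q hq; simp only [List.mem_cons, List.mem_nil_iff, or_false] at hq; rcases hq with rfl | rfl | rfl <;> norm_num) (by decide +kernel))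
    (X11b.forall_mem_of_natAbs_eq_prod_pow [2, 3, 53] [17, 6, 3] (by intro q hq; simp only [List.mem_cons, List.mem_nil_iff, or_false] at hq; rcases hq with rfl | rfl | rfl <;> norm_num) (by decide +kernel))
    (fun v hvL ↦ ?_)
  simp only [List.mem_cons, List.mem_nil_iff, or_false] at hvL
  rcases hvL with h2 | h3 | h53
  · -- `v = 2`: split I17, root t = 0, c = 17, N = 1
    exact LocalTorsionAway.natCard_ker_nsmul_adicCompletion_eq_one_of_intModel_of_nodal_root hI' 2 3 (by norm_num) h2 (by decide) (by decide) (t := 0) (by decide) (E := ⟨2, 1, 1, 0, 0, 0, 0, 17, 0, 0, 17⟩) rfl tamLocal_check_50562bh1_2 (c := 17) (by decide) (by norm_num)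
  · -- `v = 3`: n1011-p17's decider, k = 2, cert = [[22, 1, 3, 0]], S = 0
    exact LocalTorsion3.natCard_ker_nsmul_three_adicCompletion_eq_one_of_check 1 (-1) 1 (-2912) 192003 (by decide +kernel) (k := 2) (cert := [((22 : ℤ), 1, 3, 0)]) (by decide +kernel) W' (by rw [hW']; norm_num) h3
  · -- `v = 53`: additive Kodaira III, value set [2]
    exact LocalTorsionAway.natCard_ker_nsmul_adicCompletion_eq_one_of_intModel_of_additive hI' 53 3 (by norm_num) h53 (by decide) (by decide) (IntModelTam.localTamagawaNumber_padic_eq_of_intModel_of_tamLocal hI' 53 (E := ⟨53, 7, 4, 0, 40, 0, 6, 3, 3, 2, 2⟩) rfl tamLocal_check_50562bh1_53 (c := 2) (by decide)) (by norm_num)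

end Summit.BirchSwinnertonDyer.Rank1Residual.Additive

end
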